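import Summits.Ventures.Crystal3D.Theorems.StickyWulffConstantPolycrystalWulffBoundRungSingleAxisOfTwoGrain

/-!
# `PolycrystalWulffBound`, line `PolyDensity`: the GENERIC (non-co-axial) TWO-GRAIN INEQUALITY at wall
# constant `c` as lane P's NAMED FACT, its monotonicity in `c`, and the TWO-LATTICE GENERIC CLASS of the
# crux BY NAME from it (crux `stmt-Ventures-19482` / v5 `stmt-Ventures-23911`; cf-p1 RULING (cvii),
# DECISIONS (cxxii)/(cxxviii); memo P-GEN-g17)

Route `StickyWulffConstant` of the venture `Summits/Ventures/Crystal3D`, second prover lane (poly-p2,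
gen 18).  Companion of `…PolycrystalWulffBoundTwoGrainTwinFact` (p691000: the CO-AXIAL pair).

* `GenericTwoGrainInequality c`: for every two crux frames `A`, `B` that are NOT co-axial (`¬ CoAx A B`,
  the crux's own clause) and every pair of disjoint polyhedral finite-volume sets `S₁, S₂`, the crux bound
  `6·2^{1/3}(√2|S₁ ∪ S₂|)^{2/3} ≤ [Per_{W A} S₁ − ι_{W A}] + [Per_{W B} S₂ − ι_{W B}] + c·ι_{Dsc 0}` holds,
  `Dsc 0` = the closed unit ball (isotropic wall density `1`), i.e. the two-grain texture with the generic
  wall charged `c` does not beat the single truncated-octahedral Wulff crystal.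
* `GenericTwoGrainInequality.mono`: `c ≤ c'` transfers the fact upward (`ι_{Dsc 0} ≥ 0` on polyhedral
  pairs, `iota_nonneg_of_poly`).
* `twoLatticeClass_of_genericTwoGrainInequality c₀`: for a crux texture (texture clause with generic
  charge `≥ c₀`; `c₀ = 13/25` is `PolycrystalWulffBoundV5`'s clause verbatim, `c₀ = 1` the v4 text's)
  with POLYHEDRAL grains all of whose lattices `A f '' Λ` are one of TWO non-co-axial lattices
  `A₀ '' Λ`, `B₀ '' Λ` — any number of grains, any arrangement, same-lattice walls of any charge `≥ 0` and
  any kernel — the crux energy bound follows from `GenericTwoGrainInequality c₀` (one call of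
  `polyBound_of_twoGrain`, p-landed `…TwoClassReduction`: equal lattices have equal bodies
  `wulffBody_eq_of_image_eq`; the co-axiality clause depends on the frames only through their lattices, so
  every cross pair is non-co-axial, hence has `m = 0`, kernel `Dsc 0` and charge `≥ c₀`).
  `twoLatticeClassV5_of_genericTwoGrainInequality` is the instance with the V5 clause (`13 / 25`) verbatim.

STATUS OF THE FACT (why it is believed — it is NOT proved in the kernel; certificate fields):
* NECESSARY: `c ≥ G_sym(A⁻¹B) := ‖h_{W A} − h_{W B}‖_∞` (a wetting slab of either grain), and
  `sup_R G_sym(R) = √5 − √3 = 0.504017…` EXACTLY, attained iff `R` or `R⁻¹` maps a `⟨111⟩` onto a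
  `⟨210⟩` (P-GEN-g17 §1; `h_W(ν) = 2|ν|₍₁₎ + |ν|₍₂₎`).  So the fact is FALSE for `c < √5 − √3`.
* SUFFICIENT, per pair (paper theorem P-GEN-g17 §2b): `c ≥ D_𝒮(A⁻¹B)`, the Knothe discrepancy of a 3D
  paired sector–Knothe calibration 𝒮 (semi-discrete split of the competitor by a PL convex function with a
  fixed fan; per-cell Knothe maps onto the matching Laguerre cells of `W A` and `W B`; `div ≥ 3 det^{1/3}`;
  crease jumps `≥ 0` by PL-convex monotonicity; interface `≤ sup |T − T*| = D_𝒮`).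
* NUMERICAL: on 344 rotations (extremal, axis and uniform random families) `min_𝒮 D_𝒮 ≤ 0.5060 < 13/25`,
  ratio to `G_sym` median 1.0015 (GEN-TABLE-g17.txt; kit jobs listed in P-GEN-g17 §4, all
  `--workitem stmt-Ventures-19482`).
* FOR ALL PAIRS at `c = 13/25` (margin 0.016 over the necessary constant): the certificate GEN-CERT
  (GEN-CERT-PREREG-g17; interval boxes over the cubic–cubic misorientation cell, or grid + modulus lemma)
  — NOT DONE at the time of writing; at `c = 1` the margin is `0.49`.
WHAT THIS IS NOT: a proof of the fact; the ALL-GENERIC MULTI-LATTICE class (three or more pairwise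
non-co-axial lattices) does NOT follow from the pairwise fact — a calibration with COMMON frames is needed
and its fixed-frame discrepancies are `0.57–0.81 > 13/25` (P-GEN-g17 §4(d)/§6; feasible only at `c₀ = 1`,
6-parameter certificate, not done); mixed twin + generic textures are open (`MixedTripleInequality`,
P-THI-g17 §9.4).  The crux is not claimed.
-/

noncomputable section

open scoped BigOperators InnerProductSpace ENNReal Pointwise
open MeasureTheory Filter Set

namespace Summit.Ventures.Crystal3D.Cruxes.PolycrystalWulffBound.PolyDensity

open Summit.Ventures.Crystal3D.Theorems
open Summit.Ventures.Crystal3D.Cruxes.TextureLiminf.TexShadow (per polytope E3)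
open Literature.MathematicalPhysics.StatisticalMechanics (fccStacking barlowStacking IsHaggSeq)

/-- **Named fact (lane P, generic pairs): the non-co-axial two-grain inequality at wall constant `c`.**
For crux frames `A, B` with `¬ CoAx A B` and disjoint polyhedral finite-volume `S₁, S₂`:
`6·2^{1/3}(√2|S₁ ∪ S₂|)^{2/3} ≤ [Per_{W A} S₁ − ι_{W A}(S₁,S₂)] + [Per_{W B} S₂ − ι_{W B}(S₂,S₁)] +
c·ι_{Dsc 0}(S₁,S₂)`.  Necessary `c ≥ √5 − √3`; sufficient per pair `c ≥ D_𝒮(A⁻¹B)` (paper, P-GEN-g17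
§2b); for all pairs at `c = 13/25` = certificate GEN-CERT (not done).  See the module docstring.  Not
proved in the kernel. -/
def GenericTwoGrainInequality (c : ℝ) : Prop :=
    let Λ : Set (EuclideanSpace ℝ (Fin 3)) := Literature.MathematicalPhysics.StatisticalMechanics.fccStacking 1 (Real.sqrt (2 / 3));
    let Brl : (ℤ → ℤ) → Set (EuclideanSpace ℝ (Fin 3)) := Literature.MathematicalPhysics.StatisticalMechanics.barlowStacking 1 (Real.sqrt (2 / 3));
    let Ax : EuclideanSpace ℝ (Fin 3) → (EuclideanSpace ℝ (Fin 3) ≃ₗᵢ[ℝ] EuclideanSpace ℝ (Fin 3)) → (EuclideanSpace ℝ (Fin 3) ≃ₗᵢ[ℝ] EuclideanSpace ℝ (Fin 3)) → Prop := fun m A B => ∃ (L : EuclideanSpace ℝ (Fin 3) ≃ₗᵢ[ℝ] EuclideanSpace ℝ (Fin 3)) (s₁ s₂ : EuclideanSpace ℝ (Fin 3)) (σ σ' : ℤ → ℤ), Literature.MathematicalPhysics.StatisticalMechanics.IsHaggSeq σ ∧ Literature.MathematicalPhysics.StatisticalMechanics.IsHaggSeq σ' ∧ L (EuclideanSpace.single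 (2 : Fin 3) (1 : ℝ)) = m ∧ A '' Λ ⊆ (fun q => L q + s₁) '' Brl σ ∧ B '' Λ ⊆ (fun q => L q + s₂) '' Brl σ';
    let CoAx : (EuclideanSpace ℝ (Fin 3) ≃ₗᵢ[ℝ] EuclideanSpace ℝ (Fin 3)) → (EuclideanSpace ℝ (Fin 3) ≃ₗᵢ[ℝ] EuclideanSpace ℝ (Fin 3)) → Prop := fun A B => ∃ m, Ax m A B;
    let Φ : EuclideanSpace ℝ (Fin 3) → ℝ := fun ν => Real.sqrt 2 / 4 * ∑ᶠ w ∈ {w ∈ Λ | ‖w‖ = 1}, |⟪w, ν⟫_ℝ|;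
    let Per : Set (EuclideanSpace ℝ (Fin 3)) → Set (EuclideanSpace ℝ (Fin 3)) → ℝ := fun K S => (⨆ (ξ : EuclideanSpace ℝ (Fin 3) → EuclideanSpace ℝ (Fin 3)) (_ : ContDiff ℝ 1 ξ ∧ HasCompactSupport ξ ∧ ∀ z, ξ z ∈ K), ENNReal.ofReal (∫ z in S, Literature.MathematicalPhysics.StatisticalMechanics.fieldDivergence ξ z)).toReal;
    let ι : Set (EuclideanSpace ℝ (Fin 3)) → Set (EuclideanSpace ℝ (Fin 3)) → Set (EuclideanSpace ℝ (Fin 3)) → ℝ := fun K S₁ S₂ => (Per K S₁ + Per K S₂ - Per K (S₁ ∪ S₂)) / 2;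
    let W : (EuclideanSpace ℝ (Fin 3) ≃ₗᵢ[ℝ] EuclideanSpace ℝ (Fin 3)) → Set (EuclideanSpace ℝ (Fin 3)) := fun A => {y | ∀ ν : EuclideanSpace ℝ (Fin 3), ⟪y, ν⟫_ℝ ≤ Φ (A.symm ν)};
    let Dsc : EuclideanSpace ℝ (Fin 3) → Set (EuclideanSpace ℝ (Fin 3)) := fun m => {y | ‖y‖ ≤ 1 ∧ ⟪y, m⟫_ℝ = 0};
    let Poly : Set (EuclideanSpace ℝ (Fin 3)) → Prop := fun S => ∃ (k : ℕ) (H : Fin k → Finset ((EuclideanSpace ℝ (Fin 3)) × ℝ)), S = ⋃ i, ⋂ p ∈ H i, {x | ⟪p.1, x⟫_ℝ < p.2};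
    ∀ (A B : EuclideanSpace ℝ (Fin 3) ≃ₗᵢ[ℝ] EuclideanSpace ℝ (Fin 3)), ¬ CoAx A B →
      ∀ S₁ S₂ : Set (EuclideanSpace ℝ (Fin 3)), Poly S₁ → Poly S₂ → volume S₁ < ⊤ → volume S₂ < ⊤ → Disjoint S₁ S₂ →
        6 * (2 : ℝ) ^ ((1 : ℝ) / 3) * (Real.sqrt 2 * (volume (S₁ ∪ S₂)).toReal) ^ ((2 : ℝ) / 3) ≤
          (Per (W A) S₁ - ι (W A) S₁ S₂) + (Per (W B) S₂ - ι (W B) S₂ S₁) + c * ι (Dsc 0) S₁ S₂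

/-- **Monotonicity in the wall constant**: the generic two-grain inequality at `c` implies it at every
`c' ≥ c` (the interface term `ι_{Dsc 0}(S₁,S₂)` of a disjoint polyhedral pair is `≥ 0`). -/
theorem GenericTwoGrainInequality.mono {c c' : ℝ} (hcc' : c ≤ c')
    (h : GenericTwoGrainInequality c) : GenericTwoGrainInequality c' := by
  intro A B hAB S₁ S₂ hP₁ hP₂ hv₁ hv₂ hd
  have h0 := h A B hAB S₁ S₂ hP₁ hP₂ hv₁ hv₂ hd
  -- `ι_{Dsc 0}(S₁, S₂) ≥ 0`: the two-grain texture `![S₁, S₂]` is polyhedral and pairwise disjoint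
  classical
  have hPoly : ∀ f : Fin 2, ∃ (k : ℕ) (H : Fin k → Finset (E3 × ℝ)),
      (![S₁, S₂] : Fin 2 → Set E3) f = ⋃ i, polytope (H i) := by
    intro f
    fin_cases f
    · exact hP₁
    · exact hP₂
  have hvol : ∀ f : Fin 2, volume ((![S₁, S₂] : Fin 2 → Set E3) f) < ⊤ := by
    intro f
    fin_cases f
    · exact hv₁
    · exact hv₂
  have hdisjG : ∀ f g : Fin 2, f ≠ g →
      Disjoint ((![S₁, S₂] : Fin 2 → Set E3) f) ((![S₁, S₂] : Fin 2 → Set E3) g) := by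
    intro f g hfg
    fin_cases f <;> fin_cases g
    · exact absurd rfl hfg
    · exact hd
    · exact hd.symm
    · exact absurd rfl hfg
  have hBc : IsCompact {y : E3 | ‖y‖ ≤ 1 ∧ ⟪y, (0 : E3)⟫_ℝ = 0} :=
    Metric.isCompact_of_isClosed_isBounded
      ((isClosed_le continuous_norm continuous_const).inter
        (isClosed_eq (continuous_id.inner continuous_const) continuous_const))
      (Metric.isBounded_closedBall.subset (cruxDisc_subset_closedBall 0))
  have h01 : (0 : Fin 2) ≠ 1 := by decide
  have hnn := iota_nonneg_of_poly (![S₁, S₂] : Fin 2 → Set E3) hPoly hvol hdisjG hBc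
    (convex_cruxDisc 0) (zero_mem_cruxDisc 0) h01
  have hG0 : (![S₁, S₂] : Fin 2 → Set E3) 0 = S₁ := rfl
  have hG1 : (![S₁, S₂] : Fin 2 → Set E3) 1 = S₂ := rfl
  rw [hG0, hG1] at hnn
  have hι := div_nonneg hnn zero_le_two
  refine h0.trans ?_
  rw [add_le_add_iff_left]
  exact mul_le_mul_of_nonneg_right hcc' hι

/-- **The TWO-LATTICE generic class of `PolycrystalWulffBound` BY NAME from the named fact** (texture
clause with generic charge `≥ c₀`): for a crux texture with polyhedral grains whose lattices are all
`A₀ '' Λ` or `B₀ '' Λ` with `¬ CoAx A₀ B₀`, the crux energy bound holds, given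
`GenericTwoGrainInequality c₀` (one call of `polyBound_of_twoGrain`). -/
theorem twoLatticeClass_of_genericTwoGrainInequality (c₀ : ℝ) (hGT : GenericTwoGrainInequality c₀) :
    let Λ : Set (EuclideanSpace ℝ (Fin 3)) := Literature.MathematicalPhysics.StatisticalMechanics.fccStacking 1 (Real.sqrt (2 / 3));
    let Brl : (ℤ → ℤ) → Set (EuclideanSpace ℝ (Fin 3)) := Literature.MathematicalPhysics.StatisticalMechanics.barlowStacking 1 (Real.sqrt (2 / 3));
    let Ax : EuclideanSpace ℝ (Fin 3) → (EuclideanSpace ℝ (Fin 3) ≃ₗᵢ[ℝ] EuclideanSpace ℝ (Fin 3)) → (EuclideanSpace ℝ (Fin 3) ≃ₗᵢ[ℝ] EuclideanSpace ℝ (Fin 3)) → Prop := fun m A B => ∃ (L : EuclideanSpace ℝ (Fin 3) ≃ₗᵢ[ℝ] EuclideanSpace ℝ (Fin 3)) (s₁ s₂ : EuclideanSpace ℝ (Fin 3)) (σ σ' : ℤ → ℤ), Literature.MathematicalPhysics.StatisticalMechanics.IsHaggSeq σ ∧ Literature.MathematicalPhysics.StatisticalMechanics.IsHaggSeq σ'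 ∧ L (EuclideanSpace.single (2 : Fin 3) (1 : ℝ)) = m ∧ A '' Λ ⊆ (fun q => L q + s₁) '' Brl σ ∧ B '' Λ ⊆ (fun q => L q + s₂) '' Brl σ';
    let CoAx : (EuclideanSpace ℝ (Fin 3) ≃ₗᵢ[ℝ] EuclideanSpace ℝ (Fin 3)) → (EuclideanSpace ℝ (Fin 3) ≃ₗᵢ[ℝ] EuclideanSpace ℝ (Fin 3)) → Prop := fun A B => ∃ m, Ax m A B;
    let Φ : EuclideanSpace ℝ (Fin 3) → ℝ := fun ν => Real.sqrt 2 / 4 * ∑ᶠ w ∈ {w ∈ Λ | ‖w‖ = 1}, |⟪w, ν⟫_ℝ|;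
    let Per : Set (EuclideanSpace ℝ (Fin 3)) → Set (EuclideanSpace ℝ (Fin 3)) → ℝ := fun K S => (⨆ (ξ : EuclideanSpace ℝ (Fin 3) → EuclideanSpace ℝ (Fin 3)) (_ : ContDiff ℝ 1 ξ ∧ HasCompactSupport ξ ∧ ∀ z, ξ z ∈ K), ENNReal.ofReal (∫ z in S, Literature.MathematicalPhysics.StatisticalMechanics.fieldDivergence ξ z)).toReal;
    let ι : Set (EuclideanSpace ℝ (Fin 3)) → Set (EuclideanSpace ℝ (Fin 3)) → Set (EuclideanSpace ℝ (Fin 3)) → ℝ := fun K S₁ S₂ => (Per K S₁ + Per K S₂ - Per K (S₁ ∪ S₂)) / 2;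
    let W : (EuclideanSpace ℝ (Fin 3) ≃ₗᵢ[ℝ] EuclideanSpace ℝ (Fin 3)) → Set (EuclideanSpace ℝ (Fin 3)) := fun A => {y | ∀ ν : EuclideanSpace ℝ (Fin 3), ⟪y, ν⟫_ℝ ≤ Φ (A.symm ν)};
    let Dsc : EuclideanSpace ℝ (Fin 3) → Set (EuclideanSpace ℝ (Fin 3)) := fun m => {y | ‖y‖ ≤ 1 ∧ ⟪y, m⟫_ℝ = 0};
    let Tex : (n : ℕ) → (Fin n → Set (EuclideanSpace ℝ (Fin 3))) → (Fin n → (EuclideanSpace ℝ (Fin 3) ≃ₗᵢ[ℝ] EuclideanSpace ℝ (Fin 3))) → (Fin n → Fin n → ℝ) → (Fin n → Fin n → EuclideanSpace ℝ (Fin 3)) → Prop := fun n G A c m => (∀ f : Fin n, Literature.MathematicalPhysics.StatisticalMechanics.HasFinitePerimeter (G f) ∧ volume (G f) < ⊤) ∧ (∀ f g, f ≠ g → Disjoint (G f) (G g)) ∧ (∀ f g, f ≠ g → 0 ≤ c f g) ∧ (∀ f g, f ≠ g → ¬ CoAx (A f) (A g) → m f g = 0 ∧ c₀ ≤ c f g)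 ∧ (∀ f g, f ≠ g → CoAx (A f) (A g) → A f '' Λ ≠ A g '' Λ → Ax (m f g) (A f) (A g) ∧ 1 / 2 ≤ c f g);
    let En : (n : ℕ) → (Fin n → Set (EuclideanSpace ℝ (Fin 3))) → (Fin n → (EuclideanSpace ℝ (Fin 3) ≃ₗᵢ[ℝ] EuclideanSpace ℝ (Fin 3))) → (Fin n → Fin n → ℝ) → (Fin n → Fin n → EuclideanSpace ℝ (Fin 3)) → ℝ := fun n G A c m => ∑ f : Fin n, Per (W (A f)) (G f) - ∑ f, ∑ g, (if f = g then 0 else ι (W (A f)) (G f) (G g)) + ∑ f, ∑ g, (if f = g then 0 else c f g / 2 * ι (Dsc (m f g)) (G f) (G g));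
    let Vol : (n : ℕ) → (Fin n → Set (EuclideanSpace ℝ (Fin 3))) → ℝ := fun n G => (volume (⋃ f : Fin n, G f)).toReal;
    let Poly : Set (EuclideanSpace ℝ (Fin 3)) → Prop := fun S => ∃ (k : ℕ) (H : Fin k → Finset ((EuclideanSpace ℝ (Fin 3)) × ℝ)), S = ⋃ i, ⋂ p ∈ H i, {x | ⟪p.1, x⟫_ℝ < p.2};
    ∀ (n : ℕ) (G : Fin n → Set (EuclideanSpace ℝ (Fin 3)))
      (A : Fin n → (EuclideanSpace ℝ (Fin 3) ≃ₗᵢ[ℝ] EuclideanSpace ℝ (Fin 3)))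
      (c : Fin n → Fin n → ℝ) (mm : Fin n → Fin n → EuclideanSpace ℝ (Fin 3))
      (A₀ B₀ : EuclideanSpace ℝ (Fin 3) ≃ₗᵢ[ℝ] EuclideanSpace ℝ (Fin 3)),
      ¬ CoAx A₀ B₀ → Tex n G A c mm → (∀ f, Poly (G f)) →
      (∀ f, A f '' Λ = A₀ '' Λ ∨ A f '' Λ = B₀ '' Λ) →
      6 * (2 : ℝ) ^ ((1 : ℝ) / 3) * (Real.sqrt 2 * Vol n G) ^ ((2 : ℝ) / 3) ≤ En n G A c mm := by
  intro Λ Brl Ax CoAx Φ Per ι W Dsc Tex En Vol Poly n G A c mm A₀ B₀ hAB hTex hPoly hlat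
  classical
  obtain ⟨hfin, hdisjG, hc0, hgen, -⟩ := hTex
  have hvol : ∀ f, volume (G f) < ⊤ := fun f => (hfin f).2
  rcases Nat.eq_zero_or_pos n with hn | hn
  · subst hn
    show 6 * (2 : ℝ) ^ ((1 : ℝ) / 3) * (Real.sqrt 2 * (volume (⋃ f : Fin 0, G f)).toReal) ^ ((2 : ℝ) / 3) ≤
      ∑ f : Fin 0, Per (W (A f)) (G f) - ∑ f : Fin 0, ∑ g, (if f = g then 0 else ι (W (A f)) (G f) (G g)) +
        ∑ f : Fin 0, ∑ g, (if f = g then 0 else c f g / 2 * ι (Dsc (mm f g)) (G f) (G g))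
    rw [iUnion_of_empty, measure_empty, ENNReal.toReal_zero, mul_zero, Real.zero_rpow (by norm_num),
      mul_zero]
    simp
  set W₁ : Set E3 := W A₀ with hW₁
  set W₂ : Set E3 := W B₀ with hW₂
  -- class map: grains of the first lattice
  set cls : Fin n → Bool := fun f => decide (A f '' Λ = A₀ '' Λ) with hcls
  have hlatcls : ∀ f, A f '' Λ = if cls f then A₀ '' Λ else B₀ '' Λ := by
    intro f
    by_cases h : A f '' Λ = A₀ '' Λ
    · have : cls f = true := by simp [hcls, h]
      rw [this, if_pos rfl, h]
    · have : cls f = false := by simp [hcls, h]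
      rw [this]
      simp only [Bool.false_eq_true, if_false]
      exact (hlat f).resolve_left h
  -- every grain carries `W₁` or `W₂` (equal lattices have equal bodies)
  have hWcls : ∀ f, W (A f) = if cls f then W₁ else W₂ := by
    intro f
    have hf := hlatcls f
    cases h : cls f
    · rw [h] at hf
      simp only [Bool.false_eq_true, if_false] at hf ⊢
      exact wulffBody_eq_of_image_eq hf
    · rw [h, if_pos rfl] at hf
      rw [if_pos rfl]
      exact wulffBody_eq_of_image_eq hf
  -- the two bodies and the ball kernel are admissible
  have hW₁c : IsCompact W₁ := isCompact_cruxWulffBody A₀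
  have hW₁v : Convex ℝ W₁ := convex_cruxWulffBody A₀
  have hW₁0 : (0 : E3) ∈ W₁ := zero_mem_cruxWulffBody A₀
  have hW₁s : -W₁ = W₁ := neg_cruxWulffBody_eq A₀
  have hW₂c : IsCompact W₂ := isCompact_cruxWulffBody B₀
  have hW₂v : Convex ℝ W₂ := convex_cruxWulffBody B₀
  have hW₂0 : (0 : E3) ∈ W₂ := zero_mem_cruxWulffBody B₀
  have hW₂s : -W₂ = W₂ := neg_cruxWulffBody_eq B₀
  have hDc : ∀ v : E3, IsCompact (Dsc v) := fun v =>
    Metric.isCompact_of_isClosed_isBounded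
      ((isClosed_le continuous_norm continuous_const).inter
        (isClosed_eq (continuous_id.inner continuous_const) continuous_const))
      (Metric.isBounded_closedBall.subset (cruxDisc_subset_closedBall v))
  have hDv : ∀ v : E3, Convex ℝ (Dsc v) := fun v => convex_cruxDisc v
  have hD0 : ∀ v : E3, (0 : E3) ∈ Dsc v := fun v => zero_mem_cruxDisc v
  have hDs : -Dsc 0 = Dsc 0 := by
    ext y
    show -y ∈ {y : E3 | ‖y‖ ≤ 1 ∧ ⟪y, (0 : E3)⟫_ℝ = 0} ↔ y ∈ {y : E3 | ‖y‖ ≤ 1 ∧ ⟪y, (0 : E3)⟫_ℝ = 0}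
    simp only [mem_setOf_eq, norm_neg, inner_neg_left, neg_eq_zero]
  -- the co-axiality clause depends on the frames only through their lattices
  have hCoAx_of : ∀ (X Y X' Y' : E3 ≃ₗᵢ[ℝ] E3), X '' Λ = X' '' Λ → Y '' Λ = Y' '' Λ →
      CoAx X Y → CoAx X' Y' := by
    intro X Y X' Y' hX hY hXY
    obtain ⟨m, L, s₁, s₂, σ, σ', hσ, hσ', hL, h1, h2⟩ := hXY
    refine ⟨m, L, s₁, s₂, σ, σ', hσ, hσ', hL, ?_, ?_⟩
    · show X' '' Λ ⊆ (fun q => L q + s₁) '' Brl σ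
      rw [← hX]; exact h1
    · show Y' '' Λ ⊆ (fun q => L q + s₂) '' Brl σ'
      rw [← hY]; exact h2
  have hCoAx_symm : ∀ (X Y : E3 ≃ₗᵢ[ℝ] E3), CoAx X Y → CoAx Y X := by
    intro X Y hXY
    obtain ⟨m, L, s₁, s₂, σ, σ', hσ, hσ', hL, h1, h2⟩ := hXY
    exact ⟨m, L, s₂, s₁, σ', σ, hσ', hσ, hL, h2, h1⟩
  -- cross-class pairs are non-co-axial, hence `m = 0` and charge `≥ c₀`
  have hncoax : ∀ f g, cls f ≠ cls g → ¬ CoAx (A f) (A g) := by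
    intro f g hfg hco
    have hf := hlatcls f
    have hg := hlatcls g
    cases hcf : cls f <;> cases hcg : cls g
    · exact hfg (by rw [hcf, hcg])
    · rw [hcf] at hf; rw [hcg] at hg
      simp only [Bool.false_eq_true, if_false] at hf
      rw [if_pos rfl] at hg
      exact hAB (hCoAx_symm _ _ (hCoAx_of (A f) (A g) B₀ A₀ hf hg hco))
    · rw [hcf] at hf; rw [hcg] at hg
      rw [if_pos rfl] at hf
      simp only [Bool.false_eq_true, if_false] at hg
      exact hAB (hCoAx_of (A f) (A g) A₀ B₀ hf hg hco)
    · exact hfg (by rw [hcf, hcg])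
  have hcross : ∀ f g, cls f ≠ cls g → mm f g = 0 ∧ c₀ ≤ c f g := by
    intro f g hfg
    have hfg' : f ≠ g := fun h => hfg (by rw [h])
    exact hgen f g hfg' (hncoax f g hfg)
  have hDD₀ : ∀ f g, cls f ≠ cls g → Dsc (mm f g) = Dsc 0 := by
    intro f g hfg
    rw [(hcross f g hfg).1]
  -- the reduction
  have hmain := polyBound_of_twoGrain W₁ W₂ (Dsc 0) hW₁c hW₁v hW₁0 hW₁s hW₂c hW₂v hW₂0 hW₂s
    (hDc 0) (hDv 0) (hD0 0) hDs c₀ (hGT A₀ B₀ hAB) G hPoly hvol hdisjG cls (fun f g => Dsc (mm f g))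
    (fun f g => hDc (mm f g)) (fun f g => hDv (mm f g)) (fun f g => hD0 (mm f g)) hDD₀ c hc0
    (fun f g hfg => (hcross f g hfg).2)
  have hite : ∀ f, (if cls f then W₁ else W₂) = W (A f) := fun f => (hWcls f).symm
  simp only [hite] at hmain
  show 6 * (2 : ℝ) ^ ((1 : ℝ) / 3) * (Real.sqrt 2 * (volume (⋃ f, G f)).toReal) ^ ((2 : ℝ) / 3) ≤
    (∑ f, Per (W (A f)) (G f)) - (∑ f, ∑ g, (if f = g then 0 else ι (W (A f)) (G f) (G g))) +
      ∑ f, ∑ g, (if f = g then 0 else c f g / 2 * ι (Dsc (mm f g)) (G f) (G g))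
  rw [← Finset.sum_sub_distrib]
  exact hmain

/-- **The two-lattice generic class of `PolycrystalWulffBoundV5` BY NAME** (texture clause of the V5
crux verbatim, generic charge `≥ 13/25`): given `GenericTwoGrainInequality (13/25)`, every crux texture
with polyhedral grains drawn from two non-co-axial lattices satisfies the crux energy bound. -/
theorem twoLatticeClassV5_of_genericTwoGrainInequality (hGT : GenericTwoGrainInequality (13 / 25)) :
    let Λ : Set (EuclideanSpace ℝ (Fin 3)) := Literature.MathematicalPhysics.StatisticalMechanics.fccStacking 1 (Real.sqrt (2 / 3));
    let Brl : (ℤ → ℤ) → Set (EuclideanSpace ℝ (Fin 3)) := Literature.MathematicalPhysics.StatisticalMechanics.barlowStacking 1 (Real.sqrt (2 / 3));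
    let Ax : EuclideanSpace ℝ (Fin 3) → (EuclideanSpace ℝ (Fin 3) ≃ₗᵢ[ℝ] EuclideanSpace ℝ (Fin 3)) → (EuclideanSpace ℝ (Fin 3) ≃ₗᵢ[ℝ] EuclideanSpace ℝ (Fin 3)) → Prop := fun m A B => ∃ (L : EuclideanSpace ℝ (Fin 3) ≃ₗᵢ[ℝ] EuclideanSpace ℝ (Fin 3)) (s₁ s₂ : EuclideanSpace ℝ (Fin 3)) (σ σ' : ℤ → ℤ), Literature.MathematicalPhysics.StatisticalMechanics.IsHaggSeq σ ∧ Literature.MathematicalPhysics.StatisticalMechanics.IsHaggSeq σ' ∧ L (EuclideanSpace.single (2 : Fin 3) (1 : ℝ)) = m ∧ A '' Λ ⊆ (fun q => L q + s₁) '' Brl σ ∧ B '' Λ ⊆ (fun q => L q + s₂) '' Brl σ';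
    let CoAx : (EuclideanSpace ℝ (Fin 3) ≃ₗᵢ[ℝ] EuclideanSpace ℝ (Fin 3)) → (EuclideanSpace ℝ (Fin 3) ≃ₗᵢ[ℝ] EuclideanSpace ℝ (Fin 3)) → Prop := fun A B => ∃ m, Ax m A B;
    let Φ : EuclideanSpace ℝ (Fin 3) → ℝ := fun ν => Real.sqrt 2 / 4 * ∑ᶠ w ∈ {w ∈ Λ | ‖w‖ = 1}, |⟪w, ν⟫_ℝ|;
    let Per : Set (EuclideanSpace ℝ (Fin 3)) → Set (EuclideanSpace ℝ (Fin 3)) → ℝ := fun K S => (⨆ (ξ : EuclideanSpace ℝ (Fin 3) → EuclideanSpace ℝ (Fin 3)) (_ : ContDiff ℝ 1 ξ ∧ HasCompactSupport ξ ∧ ∀ z, ξ z ∈ K), ENNReal.ofReal (∫ z in S, Literature.MathematicalPhysics.StatisticalMechanics.fieldDivergence ξ z)).toReal;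
    let ι : Set (EuclideanSpace ℝ (Fin 3)) → Set (EuclideanSpace ℝ (Fin 3)) → Set (EuclideanSpace ℝ (Fin 3)) → ℝ := fun K S₁ S₂ => (Per K S₁ + Per K S₂ - Per K (S₁ ∪ S₂)) / 2;
    let W : (EuclideanSpace ℝ (Fin 3) ≃ₗᵢ[ℝ] EuclideanSpace ℝ (Fin 3)) → Set (EuclideanSpace ℝ (Fin 3)) := fun A => {y | ∀ ν : EuclideanSpace ℝ (Fin 3), ⟪y, ν⟫_ℝ ≤ Φ (A.symm ν)};
    let Dsc : EuclideanSpace ℝ (Fin 3) → Set (EuclideanSpace ℝ (Fin 3)) := fun m => {y | ‖y‖ ≤ 1 ∧ ⟪y, m⟫_ℝ = 0};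
    let Tex : (n : ℕ) → (Fin n → Set (EuclideanSpace ℝ (Fin 3))) → (Fin n → (EuclideanSpace ℝ (Fin 3) ≃ₗᵢ[ℝ] EuclideanSpace ℝ (Fin 3))) → (Fin n → Fin n → ℝ) → (Fin n → Fin n → EuclideanSpace ℝ (Fin 3)) → Prop := fun n G A c m => (∀ f : Fin n, Literature.MathematicalPhysics.StatisticalMechanics.HasFinitePerimeter (G f) ∧ volume (G f) < ⊤) ∧ (∀ f g, f ≠ g → Disjoint (G f) (G g)) ∧ (∀ f g, f ≠ g → 0 ≤ c f g) ∧ (∀ f g, f ≠ g → ¬ CoAx (A f) (A g) → m f g = 0 ∧ 13 / 25 ≤ c f g) ∧ (∀ f g, f ≠ g → CoAx (A f) (A g) → A f '' Λ ≠ A g '' Λ → Ax (m f g) (A f) (A g) ∧ 1 / 2 ≤ c f g);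
    let En : (n : ℕ) → (Fin n → Set (EuclideanSpace ℝ (Fin 3))) → (Fin n → (EuclideanSpace ℝ (Fin 3) ≃ₗᵢ[ℝ] EuclideanSpace ℝ (Fin 3))) → (Fin n → Fin n → ℝ) → (Fin n → Fin n → EuclideanSpace ℝ (Fin 3)) → ℝ := fun n G A c m => ∑ f : Fin n, Per (W (A f)) (G f) - ∑ f, ∑ g, (if f = g then 0 else ι (W (A f)) (G f) (G g)) + ∑ f, ∑ g, (if f = g then 0 else c f g / 2 * ι (Dsc (m f g)) (G f) (G g));
    let Vol : (n : ℕ) → (Fin n → Set (EuclideanSpace ℝ (Fin 3))) → ℝ := fun n G => (volume (⋃ f : Fin n, G f)).toReal;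
    let Poly : Set (EuclideanSpace ℝ (Fin 3)) → Prop := fun S => ∃ (k : ℕ) (H : Fin k → Finset ((EuclideanSpace ℝ (Fin 3)) × ℝ)), S = ⋃ i, ⋂ p ∈ H i, {x | ⟪p.1, x⟫_ℝ < p.2};
    ∀ (n : ℕ) (G : Fin n → Set (EuclideanSpace ℝ (Fin 3)))
      (A : Fin n → (EuclideanSpace ℝ (Fin 3) ≃ₗᵢ[ℝ] EuclideanSpace ℝ (Fin 3)))
      (c : Fin n → Fin n → ℝ) (mm : Fin n → Fin n → EuclideanSpace ℝ (Fin 3))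
      (A₀ B₀ : EuclideanSpace ℝ (Fin 3) ≃ₗᵢ[ℝ] EuclideanSpace ℝ (Fin 3)),
      ¬ CoAx A₀ B₀ → Tex n G A c mm → (∀ f, Poly (G f)) →
      (∀ f, A f '' Λ = A₀ '' Λ ∨ A f '' Λ = B₀ '' Λ) →
      6 * (2 : ℝ) ^ ((1 : ℝ) / 3) * (Real.sqrt 2 * Vol n G) ^ ((2 : ℝ) / 3) ≤ En n G A c mm :=
  twoLatticeClass_of_genericTwoGrainInequality (13 / 25) hGT

/-- **The two-lattice generic class of the v4 crux `PolycrystalWulffBound` BY NAME** (texture clause of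
`stmt-Ventures-19482` verbatim, generic charge `≥ 1`): given `GenericTwoGrainInequality 1` — in particular,
by `GenericTwoGrainInequality.mono`, given the fact at any `c ≤ 1` such as `13/25` — every v4 crux texture
with polyhedral grains drawn from two non-co-axial lattices satisfies the crux energy bound. -/
theorem twoLatticeClassV4_of_genericTwoGrainInequality (hGT : GenericTwoGrainInequality 1) :
    let Λ : Set (EuclideanSpace ℝ (Fin 3)) := Literature.MathematicalPhysics.StatisticalMechanics.fccStacking 1 (Real.sqrt (2 / 3));
    let Brl : (ℤ → ℤ) → Set (EuclideanSpace ℝ (Fin 3)) := Literature.MathematicalPhysics.StatisticalMechanics.barlowStacking 1 (Real.sqrt (2 / 3));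
    let Ax : EuclideanSpace ℝ (Fin 3) → (EuclideanSpace ℝ (Fin 3) ≃ₗᵢ[ℝ] EuclideanSpace ℝ (Fin 3)) → (EuclideanSpace ℝ (Fin 3) ≃ₗᵢ[ℝ] EuclideanSpace ℝ (Fin 3)) → Prop := fun m A B => ∃ (L : EuclideanSpace ℝ (Fin 3) ≃ₗᵢ[ℝ] EuclideanSpace ℝ (Fin 3)) (s₁ s₂ : EuclideanSpace ℝ (Fin 3)) (σ σ' : ℤ → ℤ), Literature.MathematicalPhysics.StatisticalMechanics.IsHaggSeq σ ∧ Literature.MathematicalPhysics.StatisticalMechanics.IsHaggSeq σ' ∧ L (EuclideanSpace.single (2 : Fin 3) (1 : ℝ)) = m ∧ A '' Λ ⊆ (fun q => L q + s₁) '' Brl σ ∧ B '' Λ ⊆ (fun q => L q + s₂) '' Brl σ';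
    let CoAx : (EuclideanSpace ℝ (Fin 3) ≃ₗᵢ[ℝ] EuclideanSpace ℝ (Fin 3)) → (EuclideanSpace ℝ (Fin 3) ≃ₗᵢ[ℝ] EuclideanSpace ℝ (Fin 3)) → Prop := fun A B => ∃ m, Ax m A B;
    let Φ : EuclideanSpace ℝ (Fin 3) → ℝ := fun ν => Real.sqrt 2 / 4 * ∑ᶠ w ∈ {w ∈ Λ | ‖w‖ = 1}, |⟪w, ν⟫_ℝ|;
    let Per : Set (EuclideanSpace ℝ (Fin 3)) → Set (EuclideanSpace ℝ (Fin 3)) → ℝ := fun K S => (⨆ (ξ : EuclideanSpace ℝ (Fin 3) → EuclideanSpace ℝ (Fin 3)) (_ : ContDiff ℝ 1 ξ ∧ HasCompactSupport ξ ∧ ∀ z, ξ z ∈ K), ENNReal.ofReal (∫ z in S, Literature.MathematicalPhysics.StatisticalMechanics.fieldDivergence ξ z)).toReal;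
    let ι : Set (EuclideanSpace ℝ (Fin 3)) → Set (EuclideanSpace ℝ (Fin 3)) → Set (EuclideanSpace ℝ (Fin 3)) → ℝ := fun K S₁ S₂ => (Per K S₁ + Per K S₂ - Per K (S₁ ∪ S₂)) / 2;
    let W : (EuclideanSpace ℝ (Fin 3) ≃ₗᵢ[ℝ] EuclideanSpace ℝ (Fin 3)) → Set (EuclideanSpace ℝ (Fin 3)) := fun A => {y | ∀ ν : EuclideanSpace ℝ (Fin 3), ⟪y, ν⟫_ℝ ≤ Φ (A.symm ν)};
    let Dsc : EuclideanSpace ℝ (Fin 3) → Set (EuclideanSpace ℝ (Fin 3)) := fun m => {y | ‖y‖ ≤ 1 ∧ ⟪y, m⟫_ℝ = 0};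
    let Tex : (n : ℕ) → (Fin n → Set (EuclideanSpace ℝ (Fin 3))) → (Fin n → (EuclideanSpace ℝ (Fin 3) ≃ₗᵢ[ℝ] EuclideanSpace ℝ (Fin 3))) → (Fin n → Fin n → ℝ) → (Fin n → Fin n → EuclideanSpace ℝ (Fin 3)) → Prop := fun n G A c m => (∀ f : Fin n, Literature.MathematicalPhysics.StatisticalMechanics.HasFinitePerimeter (G f) ∧ volume (G f) < ⊤) ∧ (∀ f g, f ≠ g → Disjoint (G f) (G g)) ∧ (∀ f g, f ≠ g → 0 ≤ c f g) ∧ (∀ f g, f ≠ g → ¬ CoAx (A f) (A g) → m f g = 0 ∧ 1 ≤ c f g) ∧ (∀ f g, f ≠ g → CoAx (A f) (A g) → A f '' Λ ≠ A g '' Λ → Ax (m f g) (A f) (A g) ∧ 1 / 2 ≤ c f g);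
    let En : (n : ℕ) → (Fin n → Set (EuclideanSpace ℝ (Fin 3))) → (Fin n → (EuclideanSpace ℝ (Fin 3) ≃ₗᵢ[ℝ] EuclideanSpace ℝ (Fin 3))) → (Fin n → Fin n → ℝ) → (Fin n → Fin n → EuclideanSpace ℝ (Fin 3)) → ℝ := fun n G A c m => ∑ f : Fin n, Per (W (A f)) (G f) - ∑ f, ∑ g, (if f = g then 0 else ι (W (A f)) (G f) (G g)) + ∑ f, ∑ g, (if f = g then 0 else c f g / 2 * ι (Dsc (m f g)) (G f) (G g));
    let Vol : (n : ℕ) → (Fin n → Set (EuclideanSpace ℝ (Fin 3))) → ℝ := fun n G => (volume (⋃ f : Fin n, G f)).toReal;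
    let Poly : Set (EuclideanSpace ℝ (Fin 3)) → Prop := fun S => ∃ (k : ℕ) (H : Fin k → Finset ((EuclideanSpace ℝ (Fin 3)) × ℝ)), S = ⋃ i, ⋂ p ∈ H i, {x | ⟪p.1, x⟫_ℝ < p.2};
    ∀ (n : ℕ) (G : Fin n → Set (EuclideanSpace ℝ (Fin 3)))
      (A : Fin n → (EuclideanSpace ℝ (Fin 3) ≃ₗᵢ[ℝ] EuclideanSpace ℝ (Fin 3)))
      (c : Fin n → Fin n → ℝ) (mm : Fin n → Fin n → EuclideanSpace ℝ (Fin 3))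
      (A₀ B₀ : EuclideanSpace ℝ (Fin 3) ≃ₗᵢ[ℝ] EuclideanSpace ℝ (Fin 3)),
      ¬ CoAx A₀ B₀ → Tex n G A c mm → (∀ f, Poly (G f)) →
      (∀ f, A f '' Λ = A₀ '' Λ ∨ A f '' Λ = B₀ '' Λ) →
      6 * (2 : ℝ) ^ ((1 : ℝ) / 3) * (Real.sqrt 2 * Vol n G) ^ ((2 : ℝ) / 3) ≤ En n G A c mm :=
  twoLatticeClass_of_genericTwoGrainInequality 1 hGT

/-- **The V5 fact implies the v4 fact** (`13/25 ≤ 1`, monotonicity in the wall constant); compose with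
`twoLatticeClassV4_of_genericTwoGrainInequality` for the two-lattice generic class of the v4 crux from the
V5 fact. -/
theorem genericTwoGrainInequality_one_of_thirteenTwentyFifths (hGT : GenericTwoGrainInequality (13 / 25)) :
    GenericTwoGrainInequality 1 :=
  hGT.mono (by norm_num)

end Summit.Ventures.Crystal3D.Cruxes.PolycrystalWulffBound.PolyDensity

end
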